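import Mathlib
import Summits.PneNP.PneNP.Theorems.Nc03AvoidResidualCoreCandStarReductionProgram
import Summits.PneNP.PneNP.Theorems.Nc03AvoidResidualCoreCandCherry

/-!
# Route Nc03AvoidResidualCore, item `CandStarReduction` (★) — the tangled-surplus solver, II: soundness

Helper file for `stmt-PneNP-19963` (sequel of `…CandStarReductionProgram`; cell pnp-ideate). Reading
lemmas for the program on a genuine pure instance `rawOf J` (`enumT_rawOf`, `isData_iff`, `apexB_iff`,
`parOf`/`epOf`/`cherryOf` specifications, `vecL_filter` — the `𝔽₂`-vector of a filtered enumeration),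
then CERTIFICATE SOUNDNESS (`cert_sound`): if candidate `k` separates every listed cherry (`consOK`),
every preimage has all forced variables `true` ((F2), `forced_true`, via the landed
`…CandCherry.apex_eq_true_of_cherry`); then every covered tangled output is affine,
`y_o ⊕ β_o = Σ_v x_v [v ∈ U_o]` (`affine_at`), so `y ⊕ β` on the covered outputs is the sum of the
columns of the true variables — inside the column space, contradicting the failed span test. No
structural fact about the instance (coverage, acyclicity) is needed on this side.

Restricted-model (NC⁰₃) range-avoidance rung F-N1b of the PneNP frontier ladder (an algorithmic reduction between
two restricted AVOID problems); nothing here bears on P vs NP.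
-/

set_option linter.dupNamespace false -- `Summit.PneNP.PneNP.…`: summit = sub-problem name (D-0017 single-conjunct layout)

namespace Summit.PneNP.PneNP.Theorems.Nc03CandStarRF

open Finset Literature.Computability.Complexity
open Summit.PneNP.PneNP.Theorems.Nc03Reduction
  (PRaw ETrip enumT inSpan indic searchOut rawOf tripOf mem_enumT_iff mem_enumT rawOf_eq Vec ind bit chi
    vecL inSpan_iff bit_add chi_dot_ind)
open Summit.PneNP.PneNP.Theorems.Nc03AvoidResidualCoreCandCherry (tangled mem_tangled apex_eq_true_of_cherry)
open Summit.PneNP.PneNP.Theorems.Nc03AvoidResidualCoreCandFewHeadsRung (eval_eq)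

variable {N M : ℕ} (J : LocalMap 3 N M)

/-! ## Reading the program on a genuine instance -/

/-- The enumerated output of index `p`. -/
abbrev eOf (p : Fin M) : ETrip := (p.val, tripOf J p)

/-- The enumeration of a genuine instance, tabulated. -/
theorem enumT_rawOf : enumT (rawOf J) = List.ofFn (eOf J) := by
  apply List.ext_getElem
  · simp [enumT, rawOf_eq]
  · intro i h1 h2
    rw [List.length_ofFn] at h2
    simp only [enumT, rawOf_eq, List.getElem_zip, List.getElem_range, List.getElem_ofFn]

/-- Reading `isData` on a genuine triple (values). -/
theorem isData_iff (p : Fin M) (u : ℕ) :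
    isData (tripOf J p) u = true ↔ (J.vars p 1).val = u ∨ (J.vars p 2).val = u := by
  simp only [isData, Bool.or_eq_true, decide_eq_true_eq, tripOf]
  constructor <;> rintro (h | h) <;> simp [h]

/-- Reading `isData` on a genuine triple (variables). -/
theorem isData_iff' (p : Fin M) (u : Fin N) :
    isData (tripOf J p) u.val = true ↔ J.vars p 1 = u ∨ J.vars p 2 = u := by
  rw [isData_iff]; simp only [Fin.val_inj]

/-- A data endpoint is read in a nonzero role. -/
theorem exists_role_of_isData {p : Fin M} {u : Fin N} (h : isData (tripOf J p) u.val = true) :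
    ∃ r : Fin 3, r ≠ 0 ∧ J.vars p r = u := by
  rcases (isData_iff' J p u).1 h with h | h
  · exact ⟨1, by decide, h⟩
  · exact ⟨2, by decide, h⟩

/-- `parOf` returns a genuine witnessing output. -/
theorem parOf_spec {u : ℕ} {e : ETrip} (h : parOf (rawOf J) u = some e) :
    ∃ p : Fin M, e = eOf J p ∧ forceW (rawOf J) u (eOf J p) = true := by
  obtain ⟨p, rfl⟩ := (mem_enumT_iff J).1 (List.mem_of_find?_eq_some h)
  exact ⟨p, rfl, List.find?_some h⟩

/-- A forced variable has a parent output. -/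
theorem exists_parOf_of_forcedB {u : ℕ} (h : forcedB (rawOf J) u = true) :
    ∃ e, parOf (rawOf J) u = some e :=
  Option.isSome_iff_exists.1 h

/-- `epOf` returns a genuine OTHER output of the same head having `u` as a datum. -/
theorem epOf_spec {u : ℕ} {e e' : ETrip} (h : epOf (rawOf J) u e = some e') :
    ∃ p' : Fin M, e' = eOf J p' ∧ p'.val ≠ e.1 ∧ (J.vars p' 0).val = e.2.1 ∧ isData (tripOf J p') u = true := by
  obtain ⟨p', rfl⟩ := (mem_enumT_iff J).1 (List.mem_of_find?_eq_some h)
  have hq := List.find?_some h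
  simp only [Bool.and_eq_true, Bool.not_eq_true', decide_eq_false_iff_not, decide_eq_true_eq] at hq
  exact ⟨p', rfl, hq.1.1, hq.1.2, hq.2⟩

/-- Reading `apexB`: two distinct outputs of head `c` with datum `u`. -/
theorem apexB_iff (c u : ℕ) : apexB (rawOf J) c u = true ↔
    ∃ p p' : Fin M, p ≠ p' ∧ (J.vars p 0).val = c ∧ (J.vars p' 0).val = c ∧
      isData (tripOf J p) u = true ∧ isData (tripOf J p') u = true := by
  unfold apexB
  simp only [List.any_eq_true, Bool.and_eq_true, Bool.not_eq_true', decide_eq_false_iff_not,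
    decide_eq_true_eq]
  constructor
  · rintro ⟨e, he, e', he', ⟨⟨⟨hne, hc⟩, hc'⟩, hd⟩, hd'⟩
    obtain ⟨p, rfl⟩ := (mem_enumT_iff J).1 he
    obtain ⟨p', rfl⟩ := (mem_enumT_iff J).1 he'
    exact ⟨p, p', fun h => hne (by rw [h]), hc, hc', hd, hd'⟩
  · rintro ⟨p, p', hne, hc, hc', hd, hd'⟩
    exact ⟨eOf J p, mem_enumT J p, eOf J p', mem_enumT J p',
      ⟨⟨⟨fun h => hne (Fin.ext h), hc⟩, hc'⟩, hd⟩, hd'⟩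

/-- A witnessing output has a second cherry output. -/
theorem epOf_ne_none {u : ℕ} {p : Fin M} (h : forceW (rawOf J) u (eOf J p) = true) :
    epOf (rawOf J) u (eOf J p) ≠ none := by
  intro hnone
  unfold forceW at h
  simp only [Bool.and_eq_true] at h
  obtain ⟨⟨-, hapex⟩, -⟩ := h
  obtain ⟨p₁, p₂, hne, hc₁, hc₂, hd₁, hd₂⟩ := (apexB_iff J _ _).1 hapex
  unfold epOf at hnone
  rw [List.find?_eq_none] at hnone
  have key : ∀ p' : Fin M, (J.vars p' 0).val = (J.vars p 0).val → isData (tripOf J p') u = true → p' = p := by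
    intro p' hc' hd'
    by_contra hp'
    have := hnone (eOf J p') (mem_enumT J p')
    simp only [Bool.and_eq_true, Bool.not_eq_true', decide_eq_false_iff_not, decide_eq_true_eq] at this
    exact this ⟨⟨fun h => hp' (Fin.ext h), hc'⟩, hd'⟩
  exact hne ((key p₁ hc₁ hd₁).trans (key p₂ hc₂ hd₂).symm)

/-- A forced variable has a cherry. -/
theorem cherryOf_isSome {u : ℕ} (h : forcedB (rawOf J) u = true) :
    ∃ p p' : Fin M, cherryOf (rawOf J) u = some (u, eOf J p, eOf J p') ∧
      parOf (rawOf J) u = some (eOf J p) ∧ epOf (rawOf J) u (eOf J p) = some (eOf J p') := by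
  obtain ⟨e, he⟩ := exists_parOf_of_forcedB J h
  obtain ⟨p, rfl, hw⟩ := parOf_spec J he
  obtain ⟨e', he'⟩ := Option.ne_none_iff_exists'.1 (epOf_ne_none J hw)
  obtain ⟨p', rfl, -⟩ := epOf_spec J he'
  exact ⟨p, p', by simp [cherryOf, he, he'], he, he'⟩

/-- The cherry of a variable below `N` is listed. -/
theorem mem_cherries {pr : PRaw} {u : ℕ} (hu : u < pr.1) {q : ℕ × ETrip × ETrip} (h : cherryOf pr u = some q) :
    q ∈ cherries pr := by
  unfold cherries
  rw [List.mem_flatten]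
  refine ⟨(cherryOf pr u).toList, List.mem_map.2 ⟨u, List.mem_range.2 hu, rfl⟩, ?_⟩
  rw [h]; simp

/-- Listed cherries are cherries of variables below `N`. -/
theorem exists_of_mem_cherries {pr : PRaw} {q : ℕ × ETrip × ETrip} (h : q ∈ cherries pr) :
    ∃ u, u < pr.1 ∧ cherryOf pr u = some q := by
  unfold cherries at h
  rw [List.mem_flatten] at h
  obtain ⟨l, hl, hq⟩ := h
  obtain ⟨u, hu, rfl⟩ := List.mem_map.1 hl
  refine ⟨u, List.mem_range.1 hu, ?_⟩
  cases hc : cherryOf pr u with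
  | none => rw [hc] at hq; simp at hq
  | some q' => rw [hc] at hq; simp at hq; rw [hq]

/-- Unfolding a cherry. -/
theorem cherryOf_eq_some {pr : PRaw} {u : ℕ} {q : ℕ × ETrip × ETrip} (h : cherryOf pr u = some q) :
    q.1 = u ∧ parOf pr u = some q.2.1 ∧ epOf pr u q.2.1 = some q.2.2 := by
  unfold cherryOf at h
  cases hp : parOf pr u with
  | none => rw [hp] at h; simp at h
  | some e =>
    rw [hp] at h
    simp only [Option.bind_some, Option.map_eq_some_iff] at h
    obtain ⟨e', he', rfl⟩ := h
    exact ⟨rfl, rfl, he'⟩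

/-! ## Forcing: a separated cherry switches its apex on -/

/-- `parOf` returns a witness. -/
theorem forceW_of_parOf {u : ℕ} {e : ETrip} (h : parOf (rawOf J) u = some e) : forceW (rawOf J) u e = true :=
  List.find?_some h

/-- `epOf` read at a genuine output. -/
theorem epOf_spec' {u : ℕ} {e : ETrip} {p' : Fin M} (h : epOf (rawOf J) u e = some (eOf J p')) :
    p'.val ≠ e.1 ∧ (J.vars p' 0).val = e.2.1 ∧ isData (tripOf J p') u = true := by
  have hq := List.find?_some h
  simp only [Bool.and_eq_true, Bool.not_eq_true', decide_eq_false_iff_not, decide_eq_true_eq] at hq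
  exact ⟨hq.1.1, hq.1.2, hq.2⟩

/-- **(F2) on the program's cherries.** If a candidate pattern separates every listed cherry, every
preimage of it has all forced variables equal to `true`. -/
theorem forced_true (hP : J.IsPure candPred) {k : ℕ} (hc : consOK (rawOf J) k = true)
    {x : Fin N → Bool} (hx : J.eval x = fun p => yB (rawOf J) k (eOf J p)) (u : Fin N)
    (hu : forcedB (rawOf J) u.val = true) : x u = true := by
  obtain ⟨p, p', hch, hpar, hep⟩ := cherryOf_isSome J hu
  have hw := forceW_of_parOf J hpar
  obtain ⟨hne, hhead, hd'⟩ := epOf_spec' J hep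
  have hsep : xor (yB (rawOf J) k (eOf J p)) (yB (rawOf J) k (eOf J p')) = true := by
    have := List.all_eq_true.1 hc _ (mem_cherries u.isLt hch)
    simpa using this
  unfold forceW at hw
  simp only [Bool.and_eq_true] at hw
  obtain ⟨⟨hd, -⟩, -⟩ := hw
  obtain ⟨r, hr, hvr⟩ := exists_role_of_isData J hd
  obtain ⟨r', hr', hvr'⟩ := exists_role_of_isData J hd'
  have hhead' : J.vars p 0 = J.vars p' 0 := (Fin.ext hhead).symm
  have hy : (fun p => yB (rawOf J) k (eOf J p)) p ≠ (fun p => yB (rawOf J) k (eOf J p)) p' := by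
    intro h
    simp only at h
    rw [h, Bool.xor_self] at hsep
    exact Bool.false_ne_true hsep
  have := apex_eq_true_of_cherry hP hx hhead' hr hr' (hvr.trans hvr'.symm) hy
  rwa [hvr] at this

/-! ## Vectors of filtered enumerations -/

/-- **Coordinates of the vector of a filtered enumeration**: the index list of the enumerated outputs
passing `q` has vector `p ↦ bit (q (p, triple p))`. -/
theorem vecL_filter (q : ETrip → Bool) :
    vecL M (((enumT (rawOf J)).filter q).map Prod.fst) = fun p => bit (q (eOf J p)) := by
  funext p
  unfold vecL
  rw [enumT_rawOf, List.ofFn_eq_map, List.count, List.countP_map, List.countP_filter, List.countP_map]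
  by_cases hq : q (eOf J p) = true
  · rw [hq, List.countP_congr (q := fun p' => p' == p)]
    · have h1 : List.countP (fun p' => p' == p) (List.finRange M) = 1 := by
        simpa [List.count] using List.count_finRange p
      rw [h1]; simp [bit]
    · intro x _
      simp only [Function.comp_apply, Bool.and_eq_true, beq_iff_eq]
      constructor
      · rintro ⟨h, -⟩; exact Fin.ext h
      · rintro rfl; exact ⟨rfl, hq⟩
  · rw [Bool.not_eq_true] at hq
    rw [hq, (List.countP_eq_zero).2]
    · simp [bit]
    · intro x _
      simp only [Function.comp_apply, Bool.and_eq_true, beq_iff_eq, not_and]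
      intro h
      have hx : x = p := Fin.ext h
      rw [hx, hq]; exact Bool.false_ne_true

/-! ## The affine read-out of a covered output -/

/-- Product of bits. -/
theorem bit_mul (p q : Bool) : bit p * bit q = bit (p && q) := by
  cases p <;> cases q <;> simp [bit]

/-- Reading a column entry on a genuine triple. -/
theorem colP_read (v : Fin N) (p : Fin M) :
    colP (rawOf J) v.val (tripOf J p) =
      ((decide (v = J.vars p 0) && !forcedB (rawOf J) (J.vars p 0).val) ||
        (decide (v = J.vars p 2) && forcedB (rawOf J) (J.vars p 1).val && !forcedB (rawOf J) (J.vars p 2).val) ||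
        (decide (v = J.vars p 1) && forcedB (rawOf J) (J.vars p 2).val && !forcedB (rawOf J) (J.vars p 1).val)) := by
  simp only [colP, tripOf, Fin.val_inj]

/-- Reading `betaB` on a genuine triple. -/
theorem betaB_read (p : Fin M) :
    betaB (rawOf J) (tripOf J p) = xor (forcedB (rawOf J) (J.vars p 0).val)
      (forcedB (rawOf J) (J.vars p 1).val && forcedB (rawOf J) (J.vars p 2).val) := rfl

/-- Reading `covB`: a covered output has a forced data endpoint. -/
theorem forced_of_covB {p : Fin M} (h : covB (rawOf J) (eOf J p) = true) :
    forcedB (rawOf J) (J.vars p 1).val = true ∨ forcedB (rawOf J) (J.vars p 2).val = true := by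
  unfold covB at h
  simp only [Bool.and_eq_true, Bool.or_eq_true] at h
  exact h.2

/-- The Boolean identity behind the affine read-out. -/
theorem affine_identity (xc xa xb Fc Fa Fb : Bool) (hc : Fc = true → xc = true)
    (ha : Fa = true → xa = true) (hb : Fb = true → xb = true) (hcov : Fa = true ∨ Fb = true) :
    bit (xor (xor xc (xa && xb)) (xor Fc (Fa && Fb))) =
      bit xc * bit (!Fc) + (bit xa * bit (Fb && !Fa) + bit xb * bit (Fa && !Fb)) := by
  revert xc xa xb Fc Fa Fb
  decide

/-- **Affine read-out.** On a preimage whose forced variables are all `true`, a covered output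
satisfies `y_o ⊕ β_o = Σ_v x_v · [v occurs in the affine form of o]`. -/
theorem affine_at (hP : J.IsPure candPred) (x : Fin N → Bool)
    (hF : ∀ u : Fin N, forcedB (rawOf J) u.val = true → x u = true) (p : Fin M)
    (hcov : covB (rawOf J) (eOf J p) = true) :
    bit (xor (J.eval x p) (betaB (rawOf J) (tripOf J p))) =
      ∑ v : Fin N, bit (x v) * bit (colP (rawOf J) v.val (tripOf J p)) := by
  have hca : J.vars p 0 ≠ J.vars p 1 := fun h => absurd (hP.2 p h) (by decide)
  have hcb : J.vars p 0 ≠ J.vars p 2 := fun h => absurd (hP.2 p h) (by decide)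
  have hab : J.vars p 1 ≠ J.vars p 2 := fun h => absurd (hP.2 p h) (by decide)
  have hsum : ∑ v : Fin N, bit (x v) * bit (colP (rawOf J) v.val (tripOf J p)) =
      ∑ v ∈ ({J.vars p 0, J.vars p 1, J.vars p 2} : Finset (Fin N)),
        bit (x v) * bit (colP (rawOf J) v.val (tripOf J p)) := by
    refine (Finset.sum_subset (Finset.subset_univ _) fun v _ hv => ?_).symm
    simp only [Finset.mem_insert, Finset.mem_singleton, not_or] at hv
    rw [colP_read]
    simp [hv.1, hv.2.1, hv.2.2, bit]
  rw [hsum, Finset.sum_insert (by simp [hca, hcb]), Finset.sum_pair hab, colP_read, colP_read, colP_read,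
    eval_eq hP, betaB_read]
  simp only [decide_true, Bool.true_and, hca, hcb, hab, hca.symm, hcb.symm, hab.symm, decide_false,
    Bool.false_and, Bool.or_false, Bool.false_or]
  exact affine_identity _ _ _ _ _ _ (hF _) (hF _) (hF _) (forced_of_covB J hcov)

/-! ## Soundness of the certificate -/

/-- The columns are listed. -/
theorem colV_mem_cols (v : Fin N) : colV (rawOf J) v.val ∈ cols (rawOf J) :=
  List.mem_map.2 ⟨v.val, List.mem_range.2 v.isLt, rfl⟩

/-- **Certificate soundness.** If candidate `k` separates every cherry and its `y ⊕ β` (on the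
covered tangled outputs) is not in the span of the columns, the pattern `yB k` is outside the range. -/
theorem cert_sound (hP : J.IsPure candPred) {k : ℕ} (hc : consOK (rawOf J) k = true)
    (hs : inSpan M (cols (rawOf J)) (tgt (rawOf J) k) = false) :
    (fun p : Fin M => yB (rawOf J) k (eOf J p)) ∉ J.range := by
  rintro ⟨x, hx⟩
  have hF := forced_true J hP hc hx
  have heq : vecL M (tgt (rawOf J) k) = ∑ v : Fin N, bit (x v) • vecL M (colV (rawOf J) v.val) := by
    funext p
    rw [Finset.sum_apply]
    simp only [Pi.smul_apply, smul_eq_mul]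
    unfold tgt colV
    rw [vecL_filter]
    simp only [vecL_filter]
    by_cases hcov : covB (rawOf J) (eOf J p) = true
    · have hy : yB (rawOf J) k (eOf J p) = J.eval x p := (congrFun hx p).symm
      rw [hy, hcov, Bool.true_and]
      simp only [Bool.true_and]
      exact affine_at J hP x hF p hcov
    · rw [Bool.not_eq_true] at hcov
      have hy : yB (rawOf J) k (eOf J p) = false := by unfold yB; rw [hcov, Bool.false_and]
      rw [hy, hcov]
      simp [bit]
  have hmem : vecL M (tgt (rawOf J) k) ∈
      Submodule.span (ZMod 2) (vecL M '' {r | r ∈ cols (rawOf J)}) := by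
    rw [heq]
    exact Submodule.sum_mem _ fun v _ =>
      Submodule.smul_mem _ _ (Submodule.subset_span ⟨colV (rawOf J) v.val, colV_mem_cols J v, rfl⟩)
  have := (inSpan_iff (cols (rawOf J)) (tgt (rawOf J) k)).2 hmem
  rw [hs] at this
  exact Bool.false_ne_true this

end Summit.PneNP.PneNP.Theorems.Nc03CandStarRF
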